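import Literature.MathematicalPhysics.QuantumFieldTheory.Balaban1983to89.B6BlockCutoffKLevelV1
import Literature.MathematicalPhysics.QuantumFieldTheory.Balaban1983to89.B6QGQTestBumpsKLevelV1
import HarnessLib

/-!
# `Balaban1983to89.B6CutoffSupportKLevelV1` — T. Bałaban, *Propagators and renormalization transformations for lattice gauge theories. II*,
Commun. Math. Phys. **96** (1984) 223–250 [Balaban1984PropagatorsII], (2.45)–(2.46) p. 231, (2.18) p. 226, Lemma 2.1 (2.61) p. 234:
**WHERE THE LOCALISED ENERGY IDENTITY LIVES** — the block cut-off of `B6BlockCutoffKLevelV1` read in the block geometry `d_T` of the k-level V1 torus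
family, the support of the averaging weights `q_i` against it, length windows and block counts near a block (file F4b of the interior-energy route
to Prop. 2.6 (2.140)₄ at k levels; cell pub-ymgap, seat dag-p1, `HOME/pub-ymgap-dag-p1/HL3-PLAN.md`; lit-balaban GAPS G-B6-2140-456).
HONEST FRAMING (programme rule): statement-level skeleton of published theorems with citation tags; proofs where landed; nothing here is a claim about
the Yang–Mills mass gap.  Lattice geometry (bookkeeping) on the torus family of seats p21/p22/r03, BY NAME; no estimate of print is asserted; THEOREMS
ONLY; nothing continuum ∕ mass-gap ∕ Clay.
WHAT IS PROVED (0 sorry; standard axioms): §1 `exists_blockCutoffT` (the cut-off around `y ∈ 𝔅` at width `L^{max(j(y)−1,1)}`: plateau on the bonds of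
`Δ(y)` and their translates, support within `d_T ≤ 4(d+1)`, Lipschitz `L^{−n}`), `dist_le_of_shift_ne`; §2 `len_le_mul_len_of_dist_lt` (adjacent levels
⇒ comparable lengths), `pow_lvl_ge_of_dist_lt`; §3 `exists_qwt_ne_zero_of_QE_ne_zero`, `blkV1_mem_metBlocks`, `dist_beta_le_of_mem_metBlocks`;
§4 `ineq261_geomT` ((2.61) on the family, from `lemma21_torus`), `sum_ind_dist_le`, `sum_ind_dist_beta_le` (block ∕ index-bond counts near `y`).
Seat `pub-ymgap-dag-p1` (prover), 2026-08-25.  NOT summit progress.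
-/

open scoped BigOperators

noncomputable section

namespace Literature.MathematicalPhysics.QuantumFieldTheory.Balaban1983to89.B6CutoffSupportKLevelV1

open Finset
open LatticeFieldCalculus
open B4TorusKernel.MultiPeriod (torusSupNorm torusSupNorm_nonneg)
open B5Eq118OneStroke (iterBlockOf iterBlock mem_iterBlock)
open B6MultiLevelBoxOperator (N0)
open B6MultiLevelTorusOperator (TDomains)
open B6CubeCoeffSizesV1 (torusSupNorm_tshift_unitVec_le)
open B6Geom246MultiLevelBox (bset blkOf scale_bounds)
open B6Geom246MultiLevelTorus (geomT bondT connectedT levelGapT lemma21_torus triangle_refl_nonneg_T torusSupNorm_neg)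
open B6GlobalChartV1 (PV domT blkV1 toBox toBox_apply)
open B6ScalarChartV1 (toBox_shift)
open B6MemberOfCubeV1 (torusSupNorm_sub_le one_le_N0)
open B6Ineq2142KLevelV1 (lvl β qwt qwt_nonneg beta_level lvl_le_mK distT_shift_le_one geomT_dist_ends_le metBlocks mem_metBlocks
  exists_of_mem_metBlocks exists_of_qwt_ne_zero iterBlockOf_runSite_mem)
open B6Prop27KLevelV1 (card_fiber_beta_le)
open B6QGQTestBumpsKLevelV1 (QE_apply_eq_sum_qwt)
open B6SectAOperatorsV1 (QE BondIdx)
open B6Lemma21Repaired (Ineq261With)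
open B6Ineq261LevelGap (K261)
open B8Ineq192MultiLevelTorus (symmT)
open B6BlockCutoffKLevelV1 (exists_blockCutoff)
open B6BlockRunsKLevelV1 (level_window_of_dist_lt)
open Literature.MathematicalPhysics.QuantumFieldTheory.BalabanImbrieJaffe1984to88.BIJ85AxialPropagator411 (BondSpace)

variable {d ℓ m K : ℕ} {hd : 1 ≤ d + 1} {hL : Odd (ℓ + 1) ∧ 1 < ℓ + 1} {Mh k R : ℕ} {P' : Fin (d + 1) → ℕ}
variable (hN : ∀ μ, N0 ℓ Mh k P' μ = (PV d ℓ m K hd hL).sitesPerDir 0) (D : TDomains d ℓ Mh k P' R) (hk : k ≤ m + K)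

/-! ## §1  The cut-off around a block, in the block geometry -/

include hk in
/-- **THE CUT-OFF AROUND `y ∈ 𝔅`** (`B6BlockCutoffKLevelV1.exists_blockCutoff` at `n = max(j(y)−1, 1)`), read on `(geomT, blkV1)`: `0 ≤ χ ≤ 1`;
`χ = 1` on every bond of `Δ(y)` and on its translates `b + e_ν`; `χ ≠ 0` only on blocks within `d_T ≤ 4(d+1)` of `y`; `|χ(b+e_ν) − χ(b)| ≤ L^{−n}`.
[cite: Balaban1984PropagatorsII, (2.45)–(2.46) p.231, Prop. 2.6 (2.140) p.247] -/
theorem exists_blockCutoffT (hMh : 1 ≤ Mh) (hP : ∀ μ, 1 ≤ P' μ) (y : ↥(bset D.toDomains))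
    (hRM : (d + 2) * 6 < R * ((ℓ + 1) * Mh) - 1) :
    ∃ (n : ℕ) (χ : PBond (PV d ℓ m K hd hL) 0 → ℝ), n = max (y.1.1 - 1) 1 ∧
      (∀ f, 0 ≤ χ f ∧ χ f ≤ 1) ∧
      (∀ b, blkV1 hN D b = y → ∀ ν : Fin (d + 1), χ b = 1 ∧ χ ⟨b.src.shift ν, b.dir⟩ = 1) ∧
      (∀ f, χ f ≠ 0 → (geomT D).dist (blkV1 hN D f) y ≤ 4 * ((d : ℝ) + 1)) ∧
      (∀ (f : PBond (PV d ℓ m K hd hL) 0) (ν : Fin (d + 1)), |χ ⟨f.src.shift ν, f.dir⟩ - χ f| ≤ ((((ℓ : ℝ) + 1)) ^ n)⁻¹) := by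
  have hsc := scale_bounds D.toDomains y
  have hn1 : 1 ≤ max (y.1.1 - 1) 1 := le_max_right _ _
  have hn : max (y.1.1 - 1) 1 ≤ m + K := by
    refine max_le ?_ (by omega); omega
  have hny : max (y.1.1 - 1) 1 + 1 ≤ y.1.1 ∨ max (y.1.1 - 1) 1 = 1 := by omega
  obtain ⟨χ, h01, hpl, hsupp, hLip⟩ := exists_blockCutoff hN D hk hMh hP hn1 hn y hny hRM
  have hN1 : ∀ μ, 1 ≤ N0 ℓ Mh k P' μ := fun μ => one_le_N0 hN μ
  have hcast : (((ℓ + 1) ^ max (y.1.1 - 1) 1 : ℕ) : ℝ) = ((ℓ : ℝ) + 1) ^ max (y.1.1 - 1) 1 := by push_cast; ring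
  refine ⟨_, χ, rfl, h01, fun b hb ν => ⟨?_, ?_⟩, fun f hf => ?_, fun f ν => ?_⟩
  · refine hpl b ⟨b.src, hb, ?_⟩
    rw [sub_self]
    have h0 : torusSupNorm (N0 ℓ Mh k P') (0 : Fin (d + 1) → ℤ) = 0 := by
      unfold torusSupNorm
      simp only [Pi.zero_apply, B4Sect5Torus.circAbs_zero, Int.cast_zero]
      exact Finset.sup'_const _ _
    rw [h0]; positivity
  · refine hpl _ ⟨b.src, hb, ?_⟩
    have h1 : torusSupNorm (N0 ℓ Mh k P') ((toBox hN (b.src.shift ν)).1 - (toBox hN b.src).1) ≤ 1 := by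
      rw [toBox_shift]; exact torusSupNorm_tshift_unitVec_le hN1 ν (toBox hN b.src)
    refine h1.trans ?_
    exact_mod_cast Nat.one_le_pow _ _ (by omega)
  · have := hsupp f hf
    show (((bondT D).dist (blkOf D.toDomains (toBox hN f.src)) y : ℕ) : ℝ) ≤ 4 * ((d : ℝ) + 1)
    have h' : (((bondT D).dist (blkOf D.toDomains (toBox hN f.src)) y : ℕ) : ℝ) ≤ (((d + 1) * 4 : ℕ) : ℝ) := by exact_mod_cast this
    refine h'.trans (le_of_eq ?_); push_cast; ring
  · rw [← hcast]; exact hLip f ν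

/-- if `χ(b + e_ν) ≠ χ(b)` then one of them is `≠ 0`, so BOTH blocks are within `r + 1` of `y` when `χ ≠ 0` only within `r`.
[cite: Balaban1984PropagatorsII, (2.45)–(2.46) p.231, bookkeeping] -/
theorem dist_le_of_shift_ne (hMh : 1 ≤ Mh) (hP : ∀ μ, 1 ≤ P' μ) (y : ↥(bset D.toDomains)) {χ : PBond (PV d ℓ m K hd hL) 0 → ℝ}
    {r : ℝ} (hsupp : ∀ f, χ f ≠ 0 → (geomT D).dist (blkV1 hN D f) y ≤ r) (b : PBond (PV d ℓ m K hd hL) 0) (ν : Fin (d + 1))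
    (hne : χ ⟨b.src.shift ν, b.dir⟩ ≠ χ b) :
    (geomT D).dist (blkV1 hN D b) y ≤ r + 1 ∧ (geomT D).dist (blkV1 hN D ⟨b.src.shift ν, b.dir⟩) y ≤ r + 1 := by
  have htri := (triangle_refl_nonneg_T D hMh hP).1
  have hnn := (triangle_refl_nonneg_T D hMh hP).2.2
  have h1 : (geomT D).dist (blkV1 hN D b) (blkV1 hN D ⟨b.src.shift ν, b.dir⟩) ≤ 1 := by
    show (((bondT D).dist (blkOf D.toDomains (toBox hN b.src)) (blkOf D.toDomains (toBox hN (b.src.shift ν))) : ℕ) : ℝ) ≤ 1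
    exact_mod_cast distT_shift_le_one hN D b.src ν
  have h1' : (geomT D).dist (blkV1 hN D ⟨b.src.shift ν, b.dir⟩) (blkV1 hN D b) ≤ 1 := by rw [symmT]; exact h1
  by_cases hb : χ b = 0
  · have hb' : χ ⟨b.src.shift ν, b.dir⟩ ≠ 0 := fun h => hne (by rw [h, hb])
    have := hsupp _ hb'
    exact ⟨(htri _ _ _).trans (by linarith), this.trans (by linarith [hnn (blkV1 hN D b) y])⟩
  · have := hsupp _ hb
    exact ⟨this.trans (by linarith [hnn (blkV1 hN D b) y]), (htri _ _ _).trans (by linarith)⟩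

/-! ## §2  Length windows -/

/-- **ADJACENT LEVELS, COMPARABLE LENGTHS**: `d_T(s,t) < R·L·M_h − 1 ⇒ ℓ(s) ≤ L·ℓ(t)`.
[cite: Balaban1984PropagatorsII, (2.2) p.224, (2.45)–(2.46) p.231] -/
theorem len_le_mul_len_of_dist_lt (hMh : 1 ≤ Mh) (hP : ∀ μ, 1 ≤ P' μ) (s t : ↥(bset D.toDomains))
    (h : (geomT D).dist s t < ((R * ((ℓ + 1) * Mh) - 1 : ℕ) : ℝ)) :
    (geomT D).len s ≤ ((ℓ : ℝ) + 1) * (geomT D).len t := by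
  have hw := level_window_of_dist_lt D hMh hP s t h
  show ((ℓ : ℝ) + 1) ^ s.1.1 * 1 ≤ ((ℓ : ℝ) + 1) * (((ℓ : ℝ) + 1) ^ t.1.1 * 1)
  rw [mul_one, mul_one, ← pow_succ']
  exact pow_le_pow_right₀ (by linarith [(Nat.cast_nonneg ℓ : (0 : ℝ) ≤ ℓ)]) (by omega)

include hk in
/-- **THE LEVEL OF A NEARBY INDEX BOND**: `d_T(β i, y) < R·L·M_h − 1 ⇒ L·L^{j(i)} ≥ ℓ(y)`.
[cite: Balaban1984PropagatorsII, (2.2) p.224, (2.45) p.231] -/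
theorem len_le_mul_pow_lvl_of_dist_lt (hMh : 1 ≤ Mh) (hP : ∀ μ, 1 ≤ P' μ) (hk1 : 1 ≤ k) (y : ↥(bset D.toDomains))
    (i : BondIdx (domT hN D hk)) (h : (geomT D).dist (β hN D hk i) y < ((R * ((ℓ + 1) * Mh) - 1 : ℕ) : ℝ)) :
    (geomT D).len y ≤ ((ℓ : ℝ) + 1) * (((ℓ + 1 : ℕ) : ℝ)) ^ (lvl hN D hk i) := by
  have hw := level_window_of_dist_lt D hMh hP _ y h
  rw [beta_level hN D hk hk1] at hw
  show ((ℓ : ℝ) + 1) ^ y.1.1 * 1 ≤ _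
  have hc : (((ℓ + 1 : ℕ) : ℝ)) = (ℓ : ℝ) + 1 := by push_cast; ring
  rw [mul_one, hc, ← pow_succ']
  exact pow_le_pow_right₀ (by linarith [(Nat.cast_nonneg ℓ : (0 : ℝ) ≤ ℓ)]) (by omega)

/-! ## §3  The support of `q_i` against the cut-off -/

/-- `(Q(χ²v))_i ≠ 0 ⇒ q_i(f) ≠ 0` and `χ(f) ≠ 0` for some bond `f`. [cite: Balaban1984PropagatorsII, (2.18) p.226, bookkeeping] -/
theorem exists_qwt_ne_zero_of_QE_ne_zero (χ v : PBond (PV d ℓ m K hd hL) 0 → ℝ) (i : BondIdx (domT hN D hk))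
    (h : QE (domT hN D hk) (WithLp.toLp 2 fun b => χ b ^ 2 * v b : BondSpace (PV d ℓ m K hd hL)) i ≠ 0) :
    ∃ f, qwt hN D hk i f ≠ 0 ∧ χ f ≠ 0 := by
  rw [QE_apply_eq_sum_qwt] at h
  obtain ⟨f, -, hf⟩ := Finset.exists_ne_zero_of_sum_ne_zero h
  refine ⟨f, left_ne_zero_of_mul hf, fun h0 => hf ?_⟩
  rw [PiLp.toLp_apply, h0]; ring

/-- `q_i(f) ≠ 0 ⇒` the block of `f` is met by the double block of `i` (r03's support computation, exported).
[cite: Balaban1984PropagatorsII, (2.18) p.226, (2.45) p.231] -/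
theorem blkV1_mem_metBlocks (i : BondIdx (domT hN D hk)) {f : PBond (PV d ℓ m K hd hL) 0} (hf : qwt hN D hk i f ≠ 0) :
    blkV1 hN D f ∈ metBlocks hN D hk i := by
  obtain ⟨x', hx', t', ht', rfl⟩ := exists_of_qwt_ne_zero hN D hk i hf
  rw [mem_iterBlock] at hx'
  refine mem_metBlocks hN D hk i ?_
  change iterBlockOf (lvl hN D hk i) (runSite x' i.1.2.dir t') = _ ∨ iterBlockOf (lvl hN D hk i) (runSite x' i.1.2.dir t') = _
  rcases iterBlockOf_runSite_mem (lvl_le_mK hN D hk i) x' i.1.2.dir ht'.le with h | h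
  · exact Or.inl (h.trans hx')
  · right; rw [h, hx']; rfl

/-- a met block is within `d_T ≤ L + 2` of `β i`. [cite: Balaban1984PropagatorsII, (2.45)–(2.46) p.231] -/
theorem dist_beta_le_of_mem_metBlocks (hk1 : 1 ≤ k) (hRM : 2 ≤ R * Mh) (hMh : 1 ≤ Mh) (hP : ∀ μ, 1 ≤ P' μ)
    (i : BondIdx (domT hN D hk)) {y₂ : ↥(bset D.toDomains)} (h : y₂ ∈ metBlocks hN D hk i) :
    (geomT D).dist (β hN D hk i) y₂ ≤ (ℓ : ℝ) + 3 := by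
  obtain ⟨z, hz, rfl⟩ := exists_of_mem_metBlocks hN D hk i h
  exact geomT_dist_ends_le hN D hk hk1 hRM hMh hP i hz

/-! ## §4  (2.61) on the family; counting blocks and index bonds near a block -/

omit hN hk in
/-- **(2.61) ON THE k-LEVEL TORUS FAMILY** at rate `a` (`α = 1`): `Σ_{y′} e^{−a d_T(y,y′)} ≤ K₂₆₁(N₀, d+1, L, 1, a)` whenever `N₀ + 1 ≤ R·L·M_h` and
`e^{−a}·L^{2(d+1)/N₀} < 1`. [cite: Balaban1984PropagatorsII, Lemma 2.1 (2.61) p.234] -/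
theorem ineq261_geomT (hMh : 1 ≤ Mh) (hP : ∀ μ, 1 ≤ P' μ) {N₀ : ℕ} (hN₀ : 0 < N₀) (hRM : N₀ + 1 ≤ R * ((ℓ + 1) * Mh))
    {a : ℝ} (ha : 0 ≤ a) (hθ : Real.exp (-a) * ((ℓ : ℝ) + 1) ^ ((2 * (d + 1 : ℕ) : ℝ) / N₀) < 1) :
    Ineq261With (K261 N₀ (d + 1) ((ℓ : ℝ) + 1) 1 a) (geomT D) a 1 := by
  have h := (lemma21_torus D hMh hP hN₀ hRM ha zero_le_one le_rfl (by rwa [one_mul])).2.1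
  rwa [one_mul] at h

omit hN hk in
/-- **THE NUMBER OF BLOCKS WITHIN `r` OF `y`** is `≤ e^{ar}·K` under (2.61) at rate `a`.
[cite: Balaban1984PropagatorsII, Lemma 2.1 (2.61) p.234, bookkeeping] -/
theorem sum_ind_dist_le {Kc a : ℝ} (h261 : Ineq261With Kc (geomT D) a 1) (ha : 0 ≤ a) (y : ↥(bset D.toDomains)) (r : ℝ) :
    ∑ y₂ : ↥(bset D.toDomains), (if (geomT D).dist y₂ y ≤ r then (1 : ℝ) else 0) ≤ Real.exp (a * r) * Kc := by
  classical
  have hy := h261 y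
  rw [one_mul] at hy
  calc ∑ y₂ : ↥(bset D.toDomains), (if (geomT D).dist y₂ y ≤ r then (1 : ℝ) else 0)
      ≤ ∑ y₂ : ↥(bset D.toDomains), Real.exp (a * r) * Real.exp (-(a * (geomT D).dist y y₂)) :=
        Finset.sum_le_sum fun y₂ _ => by
          split_ifs with h
          · rw [← Real.exp_add, ← Real.exp_zero]
            apply Real.exp_le_exp.2
            rw [symmT] at h
            nlinarith
          · positivity
    _ = Real.exp (a * r) * ∑ y₂ : ↥(bset D.toDomains), Real.exp (-(a * (geomT D).dist y y₂)) := by rw [Finset.mul_sum]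
    _ ≤ Real.exp (a * r) * Kc := mul_le_mul_of_nonneg_left hy (Real.exp_pos _).le

/-- **THE NUMBER OF INDEX BONDS `i` WITH `β i` WITHIN `r` OF `y`** is `≤ 2(d+1)·e^{ar}·K`.
[cite: Balaban1984PropagatorsII, Lemma 2.1 (2.61) p.234, (2.45) p.231, bookkeeping] -/
theorem sum_ind_dist_beta_le (hk1 : 1 ≤ k) {Kc a : ℝ} (h261 : Ineq261With Kc (geomT D) a 1) (ha : 0 ≤ a)
    (y : ↥(bset D.toDomains)) (r : ℝ) :
    ∑ i : BondIdx (domT hN D hk), (if (geomT D).dist (β hN D hk i) y ≤ r then (1 : ℝ) else 0) ≤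
      2 * ((d : ℝ) + 1) * (Real.exp (a * r) * Kc) := by
  classical
  set g : ↥(bset D.toDomains) → ℝ := fun y₂ => if (geomT D).dist y₂ y ≤ r then (1 : ℝ) else 0 with hg
  have hg0 : ∀ y₂, 0 ≤ g y₂ := fun y₂ => by simp only [hg]; split_ifs <;> norm_num
  have h1 : ∑ i : BondIdx (domT hN D hk), (if (geomT D).dist (β hN D hk i) y ≤ r then (1 : ℝ) else 0) =
      ∑ i : BondIdx (domT hN D hk), g (β hN D hk i) := rfl
  rw [h1, Finset.sum_comp]
  calc ∑ y₂ ∈ Finset.univ.image (β hN D hk), (Finset.univ.filter fun i => β hN D hk i = y₂).card • g y₂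
      ≤ ∑ y₂ ∈ Finset.univ.image (β hN D hk), (2 * ((d : ℝ) + 1)) * g y₂ := Finset.sum_le_sum fun y₂ _ => by
        rw [nsmul_eq_mul]
        refine mul_le_mul_of_nonneg_right ?_ (hg0 y₂)
        exact_mod_cast card_fiber_beta_le hN D hk hk1 y₂
    _ ≤ ∑ y₂, (2 * ((d : ℝ) + 1)) * g y₂ :=
        Finset.sum_le_sum_of_subset_of_nonneg (Finset.subset_univ _) fun y₂ _ _ => mul_nonneg (by positivity) (hg0 y₂)
    _ = 2 * ((d : ℝ) + 1) * ∑ y₂, g y₂ := by rw [Finset.mul_sum]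
    _ ≤ 2 * ((d : ℝ) + 1) * (Real.exp (a * r) * Kc) :=
        mul_le_mul_of_nonneg_left (sum_ind_dist_le D h261 ha y r) (by positivity)

end Literature.MathematicalPhysics.QuantumFieldTheory.Balaban1983to89.B6CutoffSupportKLevelV1
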